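import Summits.QuantumFields.YangMills.Theorems.SwapVirialDeficitQuantitativeLaplaceFibredCubic
import Literature.Analysis.Asymptotics.LaplaceMethodChart
import HarnessLib

/-!
# The fibred chart wrapper made CORE-AGNOSTIC (any tube estimate), and its instance with the cubic `O(β^{−1/2})` core
# (free-hands support of ⟨stmt-QuantumFields-24197⟩ `SwapVirialDeficit.SwapGluedStiffness`; generic, sequel of ✓`…QuantitativeLaplaceFibredChart` and
# ✓`…QuantitativeLaplaceFibredCubic`)

* ★★ `laplaceMethod_chart_of_tube` — the ABSTRACT chart step on a finite measure space `(X, μ)`: a measurable `Ψ : Z → X` (ANY parameter space `Z` with a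
  measure `κ`), a measurable tube `T ⊆ Z` with `Ψ(T)` measurable and the chart identity `μ|_{Ψ(T)} = Ψ_*((J·κ)|_T)` (`J ≥ 0` on `T`), a TUBE ESTIMATE in
  coordinates — `e^{−β(f∘Ψ − f₀)}·(J·φ∘Ψ)` integrable on `T` with `|∫_T … dκ − Main| ≤ E` — and off the tube `f ≥ f₀ + η₀`, `|φ| ≤ Φ₀` (`Φ₀ ≥ 0`) ⟹
  `e^{−β(f−f₀)}φ ∈ L¹(μ)` and `|∫_X e^{−β(f−f₀)}φ dμ − Main| ≤ E + Φ₀·μ(X)·e^{−βη₀}`.  No Gaussian, no dimension: pure change of variables + tail, so the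
  fibred cores (✓`laplaceMethod_quantitative_fibred`, ✓`…_fibred_cubic`, ✓`laplaceMethod_fibred_of_fibrewise`) all pass through it.
* ★★★ `laplaceMethod_quantitative_fibred_chart_cubic` — the instance `Z = M × V`, `κ = ν ⊗ dy`, `T = M × B̄_R` with the CUBIC fibre data
  (`|ρ| ≤ A₃‖y‖³`, `|η| ≤ D‖y‖`, jointly measurable, no parity): the two-sided whole-space bound with `ε = K₃/√β + 16(m+8)/(λR²β)` plus the tail — ORDER-3 jets suffice.

HONEST FRAMING: measure-theoretic glue + a proved core; width 0 by itself toward any lattice statement; ⟨24197⟩, ⟨24196⟩, ⟨24194⟩, ⟨24497⟩ and every rung ∕ summit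
statement stay OPEN; own crux ⟨22884⟩ OPEN (blocked-on ⟨19935⟩); the Yang–Mills mass gap is NOT proved; no summit is proved by a line.  Width seat
ym-line-sfw-p2-w2 g58 (cell ym-idea-1, free hands), `--supports stmt-QuantumFields-24197`.  THEOREMS ONLY (0 `def`, 0 `sorry`), standard axioms.

## References
* M. Hasenpflug, D. Rudolf, B. Sprungk, Ann. Appl. Probab. 34 (2024), §3.1 Assumption 3 (T), App. 4.1 Thm 16. [HasenpflugRudolfSprungk2024]
* K. W. Breitung, *Asymptotic Approximations for Probability Integrals*, LNM 1592 (1994), Thm 41 p. 56, §2.3 Definitions 4–5. [Breitung1994]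
-/

set_option autoImplicit false

noncomputable section

open _root_.MeasureTheory _root_.Filter _root_.Set _root_.Module _root_.Metric
open scoped _root_.Topology _root_.Real _root_.InnerProductSpace

namespace Summit.QuantumFields.YangMills.Theorems.QuantitativeLaplace

open Literature.Analysis.Asymptotics

/-! ## §1 The abstract chart step -/

section Abstract

variable {X : Type*} [MeasurableSpace X] {μ : Measure X} [IsFiniteMeasure μ]
variable {Z : Type*} [MeasurableSpace Z] {κ : Measure Z}

/-- ★★ **Core-agnostic chart step with the off-tube tail.**  See the module docstring. [cite: HasenpflugRudolfSprungk2024, §3.1 Assumption 3 (T)]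
[cite: Breitung1994, §2.3 Definitions 4–5] -/
theorem laplaceMethod_chart_of_tube {Ψ : Z → X} {T : Set Z} {J : Z → ℝ} {f φ : X → ℝ} {f₀ β η₀ Φ₀ Main E : ℝ}
    (hΨ : Measurable Ψ) (hTm : MeasurableSet T) (hΨT : MeasurableSet (Ψ '' T))
    (hJm : Measurable J) (hJ0 : ∀ z ∈ T, 0 ≤ J z)
    (hchart : μ.restrict (Ψ '' T) = ((κ.restrict T).withDensity fun z => ENNReal.ofReal (J z)).map Ψ)
    (hfm : Measurable f) (hφm : Measurable φ) (hβ : 0 < β)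
    (hTint : IntegrableOn (fun z => Real.exp (-(β * (f (Ψ z) - f₀))) * (J z * φ (Ψ z))) T κ)
    (hbd : |(∫ z in T, Real.exp (-(β * (f (Ψ z) - f₀))) * (J z * φ (Ψ z)) ∂κ) - Main| ≤ E)
    (hout : ∀ x, x ∉ Ψ '' T → f₀ + η₀ ≤ f x)
    (hΦ₀nn : 0 ≤ Φ₀) (hΦ₀ : ∀ x, x ∉ Ψ '' T → |φ x| ≤ Φ₀) :
    Integrable (fun x => Real.exp (-(β * (f x - f₀))) * φ x) μ ∧
    |(∫ x, Real.exp (-(β * (f x - f₀))) * φ x ∂μ) - Main| ≤ E + Φ₀ * μ.real univ * Real.exp (-(β * η₀)) := by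
  set F : X → ℝ := fun x => Real.exp (-(β * (f x - f₀))) * φ x with hFdef
  have hFm : Measurable F := (((hfm.sub measurable_const).const_mul β).neg.exp).mul hφm
  -- the tube through the chart
  have hJF : ∀ z : Z, J z * F (Ψ z) = Real.exp (-(β * (f (Ψ z) - f₀))) * (J z * φ (Ψ z)) := fun z => by
    simp only [hFdef]; ring
  have hTint' : IntegrableOn (fun z => J z * F (Ψ z)) T κ := hTint.congr_fun (fun z _ => (hJF z).symm) hTm
  have hinT : IntegrableOn F (Ψ '' T) μ := (integrableOn_image_iff_of_chart hΨ hTm hJm hJ0 hchart hFm).2 hTint'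
  have htube : ∫ x in Ψ '' T, F x ∂μ = ∫ z in T, Real.exp (-(β * (f (Ψ z) - f₀))) * (J z * φ (Ψ z)) ∂κ := by
    rw [setIntegral_image_eq_of_chart hΨ hTm hJm hJ0 hchart hFm]
    exact setIntegral_congr_fun hTm fun z _ => hJF z
  -- the complement
  have hFout : ∀ x ∈ (Ψ '' T)ᶜ, ‖F x‖ ≤ Φ₀ * Real.exp (-(β * η₀)) := by
    intro x hx
    rw [Set.mem_compl_iff] at hx
    rw [Real.norm_eq_abs, hFdef]
    simp only [abs_mul, abs_of_pos (Real.exp_pos _)]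
    rw [mul_comm]
    refine mul_le_mul (hΦ₀ x hx) ?_ (Real.exp_pos _).le hΦ₀nn
    rw [Real.exp_le_exp]
    have := hout x hx
    nlinarith
  have hμc : μ ((Ψ '' T)ᶜ) < ⊤ := measure_lt_top μ _
  have houtT : IntegrableOn F (Ψ '' T)ᶜ μ :=
    Measure.integrableOn_of_bounded hμc.ne hFm.aestronglyMeasurable
      ((ae_restrict_iff' hΨT.compl).mpr (Eventually.of_forall fun x hx => hFout x hx))
  have hFint : Integrable F μ := by
    have h := hinT.union houtT
    rwa [Set.union_compl_self, integrableOn_univ] at h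
  have htail : |∫ x in (Ψ '' T)ᶜ, F x ∂μ| ≤ Φ₀ * μ.real univ * Real.exp (-(β * η₀)) := by
    have h1 := norm_setIntegral_le_of_norm_le_const hμc hFout
    rw [Real.norm_eq_abs] at h1
    refine h1.trans ?_
    have h2 : μ.real ((Ψ '' T)ᶜ) ≤ μ.real univ := measureReal_mono (Set.subset_univ _) (measure_ne_top μ _)
    have h3 : 0 ≤ Φ₀ * Real.exp (-(β * η₀)) := mul_nonneg hΦ₀nn (Real.exp_pos _).le
    calc Φ₀ * Real.exp (-(β * η₀)) * μ.real ((Ψ '' T)ᶜ) ≤ Φ₀ * Real.exp (-(β * η₀)) * μ.real univ :=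
        mul_le_mul_of_nonneg_left h2 h3
      _ = Φ₀ * μ.real univ * Real.exp (-(β * η₀)) := by ring
  refine ⟨hFint, ?_⟩
  have hsplit : ∫ x, F x ∂μ = (∫ x in Ψ '' T, F x ∂μ) + ∫ x in (Ψ '' T)ᶜ, F x ∂μ := (integral_add_compl hΨT hFint).symm
  rw [hsplit, htube]
  have e : (∫ z in T, Real.exp (-(β * (f (Ψ z) - f₀))) * (J z * φ (Ψ z)) ∂κ) + (∫ x in (Ψ '' T)ᶜ, F x ∂μ) - Main =
      ((∫ z in T, Real.exp (-(β * (f (Ψ z) - f₀))) * (J z * φ (Ψ z)) ∂κ) - Main) + ∫ x in (Ψ '' T)ᶜ, F x ∂μ := by ring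
  calc |(∫ z in T, Real.exp (-(β * (f (Ψ z) - f₀))) * (J z * φ (Ψ z)) ∂κ) + (∫ x in (Ψ '' T)ᶜ, F x ∂μ) - Main|
      = |((∫ z in T, Real.exp (-(β * (f (Ψ z) - f₀))) * (J z * φ (Ψ z)) ∂κ) - Main) + ∫ x in (Ψ '' T)ᶜ, F x ∂μ| := by rw [e]
    _ ≤ |(∫ z in T, Real.exp (-(β * (f (Ψ z) - f₀))) * (J z * φ (Ψ z)) ∂κ) - Main| + |∫ x in (Ψ '' T)ᶜ, F x ∂μ| := abs_add_le _ _
    _ ≤ _ := add_le_add hbd htail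

end Abstract

/-! ## §2 The instance with the cubic core -/

section Cubic

variable {X : Type*} [MeasurableSpace X] {μ : Measure X} [IsFiniteMeasure μ]
variable {M : Type*} [MeasurableSpace M] {ν : Measure M} [SFinite ν]
variable {V : Type*} [NormedAddCommGroup V] [InnerProductSpace ℝ V] [FiniteDimensional ℝ V]
  [MeasurableSpace V] [BorelSpace V]

/-- ★★★ **Quantitative Morse–Bott Laplace method through a fibred chart, CUBIC fibre data** (`O(β^{−1/2})`; order-3 jets suffice): under the fibred
chart identity `μ|_{Ψ(M×B̄_R)} = Ψ_*((J·ν⊗dy)|_{M×B̄_R})`, fibre data `f(Ψ(p,y)) − f₀ = ½⟪A p y,y⟫ + ρ(p,y)`, `J(p,y)φ(Ψ(p,y)) = w₀(p)(1 + η(p,y))` on the ball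
with `|ρ| ≤ A₃‖y‖³`, `|η| ≤ D‖y‖` (jointly measurable), `A₃R ≤ λ/(8(m+8))`, `DR ≤ 1`, off-tube `f ≥ f₀ + η₀`, `|φ| ≤ Φ₀`:
`|∫_X e^{−β(f−f₀)}φ dμ − 𝔐(β)| ≤ (K₃/√β + 16(m+8)/(λR²β))·𝔐(β) + Φ₀·μ(X)·e^{−βη₀}`, `𝔐(β) = (2π/β)^{m/2}∫_M w₀/√det(A p) dν`.
[cite: Breitung1994, Thm 41 p. 56] [cite: HasenpflugRudolfSprungk2024, App. 4.1 Thm 16] -/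
theorem laplaceMethod_quantitative_fibred_chart_cubic {Ψ : M × V → X} {J : M × V → ℝ} {f φ : X → ℝ} {f₀ : ℝ}
    {A : M → V →ₗ[ℝ] V} (hA : ∀ p, (A p).IsSymmetric) {lam : ℝ} (hlam : 0 < lam)
    (hcoer : ∀ p (y : V), lam * ‖y‖ ^ 2 ≤ ⟪A p y, y⟫_ℝ)
    (hAm : Measurable fun z : M × V => ⟪A z.1 z.2, z.2⟫_ℝ)
    {R A₃ D β η₀ Φ₀ : ℝ} (hR : 0 < R) (hA₃ : 0 ≤ A₃) (hD : 0 ≤ D) (hβ : 0 < β)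
    (hsmall : A₃ * R ≤ lam / (8 * ((finrank ℝ V : ℝ) + 8))) (hDR : D * R ≤ 1)
    (hΨ : Measurable Ψ) (hΨT : MeasurableSet (Ψ '' (univ ×ˢ closedBall (0 : V) R)))
    (hJm : Measurable J) (hJ0 : ∀ z ∈ (univ : Set M) ×ˢ closedBall (0 : V) R, 0 ≤ J z)
    (hchart : μ.restrict (Ψ '' (univ ×ˢ closedBall (0 : V) R)) =
      (((ν.prod volume).restrict (univ ×ˢ closedBall (0 : V) R)).withDensity fun z => ENNReal.ofReal (J z)).map Ψ)
    (hfm : Measurable f) (hφm : Measurable φ)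
    {ρ η : M × V → ℝ} {w₀ : M → ℝ} (hρ_meas : Measurable ρ) (hη_meas : Measurable η)
    (hw₀m : Measurable w₀) (hw₀ : ∀ p, 0 ≤ w₀ p) (hw₀i : Integrable w₀ ν)
    (hρ : ∀ p (y : V), ‖y‖ ≤ R → |ρ (p, y)| ≤ A₃ * ‖y‖ ^ 3) (hη : ∀ p (y : V), ‖y‖ ≤ R → |η (p, y)| ≤ D * ‖y‖)
    (hf : ∀ p (y : V), ‖y‖ ≤ R → f (Ψ (p, y)) - f₀ = (1 / 2) * ⟪A p y, y⟫_ℝ + ρ (p, y))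
    (hw : ∀ p (y : V), ‖y‖ ≤ R → J (p, y) * φ (Ψ (p, y)) = w₀ p * (1 + η (p, y)))
    (hout : ∀ x, x ∉ Ψ '' (univ ×ˢ closedBall (0 : V) R) → f₀ + η₀ ≤ f x)
    (hΦ₀nn : 0 ≤ Φ₀) (hΦ₀ : ∀ x, x ∉ Ψ '' (univ ×ˢ closedBall (0 : V) R) → |φ x| ≤ Φ₀) :
    Integrable (fun x => Real.exp (-(β * (f x - f₀))) * φ x) μ ∧
    |(∫ x, Real.exp (-(β * (f x - f₀))) * φ x ∂μ) -
        (2 * π / β) ^ ((finrank ℝ V : ℝ) / 2) * ∫ p, w₀ p / Real.sqrt (LinearMap.det (A p)) ∂ν| ≤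
      ((16 * A₃ * ((finrank ℝ V : ℝ) + 8) / lam + 256 * A₃ * ((finrank ℝ V : ℝ) + 8) ^ 2 / lam ^ 2 + D + 8 * D * ((finrank ℝ V : ℝ) + 8) / lam) /
          Real.sqrt β + 16 * ((finrank ℝ V : ℝ) + 8) / (lam * R ^ 2) / β) *
        ((2 * π / β) ^ ((finrank ℝ V : ℝ) / 2) * ∫ p, w₀ p / Real.sqrt (LinearMap.det (A p)) ∂ν) +
      Φ₀ * μ.real univ * Real.exp (-(β * η₀)) := by
  set T : Set (M × V) := (univ : Set M) ×ˢ closedBall (0 : V) R with hTdef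
  have hTm : MeasurableSet T := MeasurableSet.univ.prod measurableSet_closedBall
  -- the pulled-back data and the fibred cubic estimate on the tube
  set ft : M × V → ℝ := fun z => f (Ψ z) - f₀ with hft
  set wt : M × V → ℝ := fun z => J z * φ (Ψ z) with hwt
  have hftm : Measurable ft := (hfm.comp hΨ).sub measurable_const
  have hwtm : Measurable wt := hJm.mul (hφm.comp hΨ)
  obtain ⟨hTint, -, hbd⟩ := laplaceMethod_quantitative_fibred_cubic (f := ft) (w := wt) hA hlam hcoer hAm hR hA₃ hD hβ hsmall hDR hftm hwtm
    hρ_meas hη_meas hw₀m hw₀ hw₀i hρ hη (fun p y hy => by simp only [hft]; exact hf p y hy) (fun p y hy => by simp only [hwt]; exact hw p y hy)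
  exact laplaceMethod_chart_of_tube (κ := ν.prod volume) hΨ hTm hΨT hJm hJ0 hchart hfm hφm hβ hTint hbd hout hΦ₀nn hΦ₀

end Cubic

/-! ## §3 (appended 2026-08-31, same seat) Off-tube control ALMOST EVERYWHERE and on the PRODUCT `e^{−β(f−f₀)}·φ` only

In the bulk∕tip split of the LEAD plan the tube is `B × B̄(0,R)` over the BULK base `B` only; off the tube there are tip valley points where `f = f₀`, so the
pointwise hypothesis `hout : f ≥ f₀ + η₀ off the tube` of §1–§2 fails.  What the proof uses is only an a.e. bound of the PRODUCT `|e^{−β(f x−f₀)}·φ x| ≤ E_off`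
off the tube — which the consumer meets with `φ := 1_{bulk cylinder}·φ₀` (outside the cylinder `φ = 0`; inside it but off the tube `f ≥ f₀ + η₀`).  -/

section OffBound

variable {X : Type*} [MeasurableSpace X] {μ : Measure X} [IsFiniteMeasure μ]
variable {Z : Type*} [MeasurableSpace Z] {κ : Measure Z}

/-- ★★ **Core-agnostic chart step, off-tube bound on the product and only a.e.**: as ✓`laplaceMethod_chart_of_tube`, with `hout`∕`hΦ₀` replaced by
`hoff : ∀ᵐ x ∂μ, x ∉ Ψ(T) → ‖e^{−β(f x − f₀)}·φ x‖ ≤ E_off` (`0 ≤ E_off`); conclusion `|∫_X e^{−β(f−f₀)}φ dμ − Main| ≤ E + E_off·μ(X)`.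
[cite: HasenpflugRudolfSprungk2024, §3.1 Assumption 3 (T)] -/
theorem laplaceMethod_chart_of_tube_offBound {Ψ : Z → X} {T : Set Z} {J : Z → ℝ} {f φ : X → ℝ} {f₀ β Eoff Main E : ℝ}
    (hΨ : Measurable Ψ) (hTm : MeasurableSet T) (hΨT : MeasurableSet (Ψ '' T))
    (hJm : Measurable J) (hJ0 : ∀ z ∈ T, 0 ≤ J z)
    (hchart : μ.restrict (Ψ '' T) = ((κ.restrict T).withDensity fun z => ENNReal.ofReal (J z)).map Ψ)
    (hfm : Measurable f) (hφm : Measurable φ)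
    (hTint : IntegrableOn (fun z => Real.exp (-(β * (f (Ψ z) - f₀))) * (J z * φ (Ψ z))) T κ)
    (hbd : |(∫ z in T, Real.exp (-(β * (f (Ψ z) - f₀))) * (J z * φ (Ψ z)) ∂κ) - Main| ≤ E)
    (hEoff : 0 ≤ Eoff) (hoff : ∀ᵐ x ∂μ, x ∉ Ψ '' T → ‖Real.exp (-(β * (f x - f₀))) * φ x‖ ≤ Eoff) :
    Integrable (fun x => Real.exp (-(β * (f x - f₀))) * φ x) μ ∧
    |(∫ x, Real.exp (-(β * (f x - f₀))) * φ x ∂μ) - Main| ≤ E + Eoff * μ.real univ := by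
  set F : X → ℝ := fun x => Real.exp (-(β * (f x - f₀))) * φ x with hFdef
  have hFm : Measurable F := (((hfm.sub measurable_const).const_mul β).neg.exp).mul hφm
  have hJF : ∀ z : Z, J z * F (Ψ z) = Real.exp (-(β * (f (Ψ z) - f₀))) * (J z * φ (Ψ z)) := fun z => by
    simp only [hFdef]; ring
  have hTint' : IntegrableOn (fun z => J z * F (Ψ z)) T κ := hTint.congr_fun (fun z _ => (hJF z).symm) hTm
  have hinT : IntegrableOn F (Ψ '' T) μ := (integrableOn_image_iff_of_chart hΨ hTm hJm hJ0 hchart hFm).2 hTint'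
  have htube : ∫ x in Ψ '' T, F x ∂μ = ∫ z in T, Real.exp (-(β * (f (Ψ z) - f₀))) * (J z * φ (Ψ z)) ∂κ := by
    rw [setIntegral_image_eq_of_chart hΨ hTm hJm hJ0 hchart hFm]
    exact setIntegral_congr_fun hTm fun z _ => hJF z
  -- the complement, a.e.
  have hFout : ∀ᵐ x ∂μ.restrict (Ψ '' T)ᶜ, ‖F x‖ ≤ Eoff := by
    rw [ae_restrict_iff' hΨT.compl]
    filter_upwards [hoff] with x hx hxc
    exact hx (Set.notMem_of_mem_compl hxc)
  have hμc : μ ((Ψ '' T)ᶜ) < ⊤ := measure_lt_top μ _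
  have houtT : IntegrableOn F (Ψ '' T)ᶜ μ := Measure.integrableOn_of_bounded hμc.ne hFm.aestronglyMeasurable hFout
  have hFint : Integrable F μ := by
    have h := hinT.union houtT
    rwa [Set.union_compl_self, integrableOn_univ] at h
  have htail : |∫ x in (Ψ '' T)ᶜ, F x ∂μ| ≤ Eoff * μ.real univ := by
    have h1 := norm_setIntegral_le_of_norm_le_const_ae hμc hFout
    rw [Real.norm_eq_abs] at h1
    refine h1.trans ?_
    exact mul_le_mul_of_nonneg_left (measureReal_mono (Set.subset_univ _) (measure_ne_top μ _)) hEoff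
  refine ⟨hFint, ?_⟩
  have hsplit : ∫ x, F x ∂μ = (∫ x in Ψ '' T, F x ∂μ) + ∫ x in (Ψ '' T)ᶜ, F x ∂μ := (integral_add_compl hΨT hFint).symm
  rw [hsplit, htube]
  have e : (∫ z in T, Real.exp (-(β * (f (Ψ z) - f₀))) * (J z * φ (Ψ z)) ∂κ) + (∫ x in (Ψ '' T)ᶜ, F x ∂μ) - Main =
      ((∫ z in T, Real.exp (-(β * (f (Ψ z) - f₀))) * (J z * φ (Ψ z)) ∂κ) - Main) + ∫ x in (Ψ '' T)ᶜ, F x ∂μ := by ring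
  calc |(∫ z in T, Real.exp (-(β * (f (Ψ z) - f₀))) * (J z * φ (Ψ z)) ∂κ) + (∫ x in (Ψ '' T)ᶜ, F x ∂μ) - Main|
      = |((∫ z in T, Real.exp (-(β * (f (Ψ z) - f₀))) * (J z * φ (Ψ z)) ∂κ) - Main) + ∫ x in (Ψ '' T)ᶜ, F x ∂μ| := by rw [e]
    _ ≤ |(∫ z in T, Real.exp (-(β * (f (Ψ z) - f₀))) * (J z * φ (Ψ z)) ∂κ) - Main| + |∫ x in (Ψ '' T)ᶜ, F x ∂μ| := abs_add_le _ _
    _ ≤ _ := add_le_add hbd htail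

omit [MeasurableSpace X] [IsFiniteMeasure μ] [MeasurableSpace Z] in
/-- ★ **The consumer's off-tube bound from a CYLINDER**: if `φ` vanishes off a set `C ⊇ Ψ(T)` (e.g. `φ = 1_C·φ₀`, `C` the bulk cylinder), `|φ| ≤ Φ₀`, and
`f ≥ f₀ + η₀` on `C \ Ψ(T)`, then `‖e^{−β(f x − f₀)}·φ x‖ ≤ Φ₀·e^{−βη₀}` for every `x ∉ Ψ(T)` (`β ≥ 0`). [folklore] -/
theorem offTube_bound_of_cylinder {Ψ : Z → X} {T : Set Z} {C : Set X} {f φ : X → ℝ} {f₀ β η₀ Φ₀ : ℝ} (hβ : 0 ≤ β)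
    (hzero : ∀ x, x ∉ C → φ x = 0) (hΦ₀nn : 0 ≤ Φ₀) (hΦ₀ : ∀ x ∈ C, |φ x| ≤ Φ₀)
    (hout : ∀ x ∈ C, x ∉ Ψ '' T → f₀ + η₀ ≤ f x) :
    ∀ x, x ∉ Ψ '' T → ‖Real.exp (-(β * (f x - f₀))) * φ x‖ ≤ Φ₀ * Real.exp (-(β * η₀)) := by
  intro x hx
  by_cases hxC : x ∈ C
  · rw [Real.norm_eq_abs, abs_mul, abs_of_pos (Real.exp_pos _), mul_comm]
    refine mul_le_mul (hΦ₀ x hxC) ?_ (Real.exp_pos _).le hΦ₀nn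
    rw [Real.exp_le_exp]
    have := hout x hxC hx
    nlinarith
  · rw [hzero x hxC, mul_zero, norm_zero]
    exact mul_nonneg hΦ₀nn (Real.exp_pos _).le

end OffBound

section CubicOff

variable {X : Type*} [MeasurableSpace X] {μ : Measure X} [IsFiniteMeasure μ]
variable {M : Type*} [MeasurableSpace M] {ν : Measure M} [SFinite ν]
variable {V : Type*} [NormedAddCommGroup V] [InnerProductSpace ℝ V] [FiniteDimensional ℝ V]
  [MeasurableSpace V] [BorelSpace V]

/-- ★★★ **The √b bulk law with the off-tube bound on the product, a.e.** — ✓`laplaceMethod_quantitative_fibred_chart_cubic` with `hout`∕`hΦ₀` replaced by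
`hoff : ∀ᵐ x ∂μ, x ∉ Ψ(M × B̄_R) → ‖e^{−β(f x−f₀)}φ x‖ ≤ E_off`; error `(K₃∕√β + 16(m+8)∕(λR²β))·𝔐(β) + E_off·μ(X)`.  THE ENTRY POINT for the bulk of the bulk∕tip split
(take `M :=` bulk base, `φ := 1_{bulk cylinder}·φ₀`, `E_off := Φ₀e^{−βη₀}` by ✓`offTube_bound_of_cylinder`). [cite: HasenpflugRudolfSprungk2024, App. 4.1 Thm 16] -/
theorem laplaceMethod_quantitative_fibred_chart_cubic_offBound {Ψ : M × V → X} {J : M × V → ℝ} {f φ : X → ℝ} {f₀ : ℝ}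
    {A : M → V →ₗ[ℝ] V} (hA : ∀ p, (A p).IsSymmetric) {lam : ℝ} (hlam : 0 < lam)
    (hcoer : ∀ p (y : V), lam * ‖y‖ ^ 2 ≤ ⟪A p y, y⟫_ℝ)
    (hAm : Measurable fun z : M × V => ⟪A z.1 z.2, z.2⟫_ℝ)
    {R A₃ D β Eoff : ℝ} (hR : 0 < R) (hA₃ : 0 ≤ A₃) (hD : 0 ≤ D) (hβ : 0 < β)
    (hsmall : A₃ * R ≤ lam / (8 * ((finrank ℝ V : ℝ) + 8))) (hDR : D * R ≤ 1)
    (hΨ : Measurable Ψ) (hΨT : MeasurableSet (Ψ '' (univ ×ˢ closedBall (0 : V) R)))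
    (hJm : Measurable J) (hJ0 : ∀ z ∈ (univ : Set M) ×ˢ closedBall (0 : V) R, 0 ≤ J z)
    (hchart : μ.restrict (Ψ '' (univ ×ˢ closedBall (0 : V) R)) =
      (((ν.prod volume).restrict (univ ×ˢ closedBall (0 : V) R)).withDensity fun z => ENNReal.ofReal (J z)).map Ψ)
    (hfm : Measurable f) (hφm : Measurable φ)
    {ρ η : M × V → ℝ} {w₀ : M → ℝ} (hρ_meas : Measurable ρ) (hη_meas : Measurable η)
    (hw₀m : Measurable w₀) (hw₀ : ∀ p, 0 ≤ w₀ p) (hw₀i : Integrable w₀ ν)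
    (hρ : ∀ p (y : V), ‖y‖ ≤ R → |ρ (p, y)| ≤ A₃ * ‖y‖ ^ 3) (hη : ∀ p (y : V), ‖y‖ ≤ R → |η (p, y)| ≤ D * ‖y‖)
    (hf : ∀ p (y : V), ‖y‖ ≤ R → f (Ψ (p, y)) - f₀ = (1 / 2) * ⟪A p y, y⟫_ℝ + ρ (p, y))
    (hw : ∀ p (y : V), ‖y‖ ≤ R → J (p, y) * φ (Ψ (p, y)) = w₀ p * (1 + η (p, y)))
    (hEoff : 0 ≤ Eoff)
    (hoff : ∀ᵐ x ∂μ, x ∉ Ψ '' (univ ×ˢ closedBall (0 : V) R) → ‖Real.exp (-(β * (f x - f₀))) * φ x‖ ≤ Eoff) :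
    Integrable (fun x => Real.exp (-(β * (f x - f₀))) * φ x) μ ∧
    |(∫ x, Real.exp (-(β * (f x - f₀))) * φ x ∂μ) -
        (2 * π / β) ^ ((finrank ℝ V : ℝ) / 2) * ∫ p, w₀ p / Real.sqrt (LinearMap.det (A p)) ∂ν| ≤
      ((16 * A₃ * ((finrank ℝ V : ℝ) + 8) / lam + 256 * A₃ * ((finrank ℝ V : ℝ) + 8) ^ 2 / lam ^ 2 + D + 8 * D * ((finrank ℝ V : ℝ) + 8) / lam) /
          Real.sqrt β + 16 * ((finrank ℝ V : ℝ) + 8) / (lam * R ^ 2) / β) *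
        ((2 * π / β) ^ ((finrank ℝ V : ℝ) / 2) * ∫ p, w₀ p / Real.sqrt (LinearMap.det (A p)) ∂ν) +
      Eoff * μ.real univ := by
  set T : Set (M × V) := (univ : Set M) ×ˢ closedBall (0 : V) R with hTdef
  have hTm : MeasurableSet T := MeasurableSet.univ.prod measurableSet_closedBall
  set ft : M × V → ℝ := fun z => f (Ψ z) - f₀ with hft
  set wt : M × V → ℝ := fun z => J z * φ (Ψ z) with hwt
  have hftm : Measurable ft := (hfm.comp hΨ).sub measurable_const
  have hwtm : Measurable wt := hJm.mul (hφm.comp hΨ)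
  obtain ⟨hTint, -, hbd⟩ := laplaceMethod_quantitative_fibred_cubic (f := ft) (w := wt) hA hlam hcoer hAm hR hA₃ hD hβ hsmall hDR hftm hwtm
    hρ_meas hη_meas hw₀m hw₀ hw₀i hρ hη (fun p y hy => by simp only [hft]; exact hf p y hy) (fun p y hy => by simp only [hwt]; exact hw p y hy)
  exact laplaceMethod_chart_of_tube_offBound (κ := ν.prod volume) hΨ hTm hΨT hJm hJ0 hchart hfm hφm hTint hbd hEoff hoff

end CubicOff

end Summit.QuantumFields.YangMills.Theorems.QuantitativeLaplace

end
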